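import Literature.AnabelianGeometry.SemiGraphs.UniversalCoveringObj
import Literature.AnabelianGeometry.SemiGraphs.LocallyTrivialTemperedProofs

/-!
# `𝒢_∞` is a tempered covering ([SemiAnbd] §3 p. 38) — proofs

Proof-only sequel to `UniversalCoveringObj.lean`: [SemiAnbd] p. 38 "Thus, the `𝒢_{∞,i} → 𝒢` are
tempered coverings of `𝒢`" — the covering `𝒢_∞ = univCoverObj` determined by the universal
graph-covering has trivial constituent actions, hence is tempered (`CovObj.isTempered_of_trivial`),
i.e. an object of `B^temp(𝒢)`.
-/

namespace Literature.AnabelianGeometry.SemiGraphs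

namespace ProfiniteSemiGraph

universe u

variable (𝒢 : ProfiniteSemiGraph.{u}) (h𝒢 : 𝒢.IsCountable) (c₀ : 𝒢.graph.CatCarrier)

/-- **`𝒢_∞ → 𝒢` is a tempered covering** ([SemiAnbd] p. 38). [cite: MochizukiSemiAnbd2006, Prop 3.6 p.38] -/
theorem univCoverObj_isTempered : (𝒢.univCoverObj h𝒢 c₀).IsTempered :=
  CovObj.isTempered_of_trivial _ (𝒢.univCoverObj_ρ_V h𝒢 c₀) (𝒢.univCoverObj_ρ_E h𝒢 c₀)

/-- `𝒢_∞` as an object of the temperoid `B^temp(𝒢)`. [cite: MochizukiSemiAnbd2006, Prop 3.6 p.38] -/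
theorem univCoverObj_mem_bTempCat :
    ∃ T : BTempCat 𝒢, T.obj = 𝒢.univCoverObj h𝒢 c₀ :=
  ⟨⟨𝒢.univCoverObj h𝒢 c₀, 𝒢.univCoverObj_isTempered h𝒢 c₀⟩, rfl⟩

end ProfiniteSemiGraph

end Literature.AnabelianGeometry.SemiGraphs
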